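import Literature.AlgebraicGeometry.HodgeTheory.CycleClassPushforward
import Literature.AlgebraicGeometry.HodgeTheory.CorrespondenceActionHodgeClassesOfGysinResolved
import Literature.AlgebraicGeometry.HodgeTheory.AbelianVarietyPullbackAlgebraicClasses
import Literature.AlgebraicGeometry.Motives.PlaneFamilyRelation
import Literature.AlgebraicGeometry.Resolution.AlterationsResolution
import Literature.AlgebraicGeometry.Morphisms.FiniteCoverShrink
import HarnessLib

/-!
# Degree bookkeeping for Fulton's degree formula (complex orientations)

Family `hodge`, layer `Literature/AlgebraicGeometry/HodgeTheory`. Two bookkeeping statements about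
push-forwards of fundamental cycles (Fulton, *Intersection Theory*, §1.4: `f_*[V] = deg(V/f V) [f V]`),
isolated from hypothesis `h5` ("resolving the rational map `τ⁻¹ ∘ g`") of
`Fulton1998_degreeFormula_complexOrientation_of` (`ComplexOrientationDegreeFormulaReduction`):

* `base_eq_and_residueFieldMap_surjective_of_map_primeCycle` — if `g_*[V] = k • [Z]` (`k ≥ 1`) and
  `τ_*[W] = [Z]` for the prime cycle `[Z]` of a point `z`, then `g η_V = z = τ η_W` and
  `κ(z) → κ(η_W)` is onto (residue degree `1`);
* `exists_resolution_of_degree_eq_of_comp_eq` — on a commutative square `p ≫ g = q ≫ τ` of smooth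
  projective varieties with `p : T ⟶ V` birational, `g_*[V] = k • [Z]`, `τ_*[W] = [Z]` and
  `dim V = dim W = d`: `dim T = d`, `q` maps the generic point of `T` to that of `W`, and
  `q_*[T] = k • [W]` — from `τ_* q_*[T] = g_* p_*[T] = g_*[V] = k • [Z]` (functoriality of proper
  push-forward, Stacks 02R5) and the uniqueness of the point of top dimension.

## References

* [Fulton1998] W. Fulton, Intersection Theory, 2nd ed., Springer 1998, §1.4 and Lemma 19.1.2.
* [StacksProject] The Stacks Project, Tag 02R5.
-/

noncomputable section

open CategoryTheory AlgebraicGeometry Order Set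
open Literature.AlgebraicGeometry.Motives

namespace Literature.AlgebraicGeometry.HodgeTheory

section HodgeTheory

/-- Push-forward of cycles along equal morphisms agree (the quasi-compactness instances being
propositions). [folklore] -/
private theorem algebraicCycleMap_congr {X' Y' : Scheme} {f₁ f₂ : X' ⟶ Y'} (h : f₁ = f₂)
    [QuasiCompact f₁] [QuasiCompact f₂] {N : Type*} [DecidableEq N] (wx : X' → N) (wy : Y' → N)
    (c : AlgebraicCycle X' ℤ) : AlgebraicCycle.map f₁ wx wy c = AlgebraicCycle.map f₂ wx wy c := by
  subst h
  rfl

/-- A field extension of degree `1` is trivial: if `[κ(x) : κ(f x)] = 1` then `κ(f x) → κ(x)` is onto.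
[folklore] -/
theorem residueFieldMap_surjective_of_residueDegree_eq_one {X Y : Scheme} (f : X ⟶ Y) (x : X)
    (h : f.residueDegree x = 1) : Function.Surjective (f.residueFieldMap x) := by
  letI := (f.residueFieldMap x).hom.toAlgebra
  intro a
  obtain ⟨c, hc⟩ := (finrank_eq_one_iff_of_nonzero' (1 : X.residueField x) one_ne_zero).mp h a
  refine ⟨c, ?_⟩
  rw [← hc, Algebra.smul_def, mul_one]
  rfl

/-- **Bookkeeping of the cycle equations of the degree formula.** For `g : V ⟶ X`, `τ : W ⟶ X` with
`g_*[closure {η}] = k • [closure {z}]`, `k ≥ 1`, and `τ_*[closure {ω}] = [closure {z}]`: `g η = z`,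
`τ ω = z`, and the residue field extension `κ(z) → κ(ω)` is onto (its degree, the push-forward
coefficient, is `1`). [cite: Fulton1998, §1.4] -/
theorem base_eq_and_residueFieldMap_surjective_of_map_primeCycle :
    ∀ ⦃n d : ℕ⦄ ⦃X V W : Motives.SchemeOver ℂ⦄ (_hX : Motives.IsSmoothProjective n X)
      (_hV : Motives.IsSmoothProjective d V) (_hW : Motives.IsSmoothProjective d W)
      (g : V ⟶ X) (τ : W ⟶ X) [QuasiCompact g.left] [QuasiCompact τ.left] ⦃η : V.left⦄ ⦃ω : W.left⦄,
      IsGenericPoint η Set.univ → IsGenericPoint ω Set.univ → ∀ ⦃z : X.left⦄ ⦃k : ℕ⦄, 0 < k →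
      AlgebraicCycle.map g.left Order.height Order.height (Motives.primeCycle η) = k • Motives.primeCycle z →
      AlgebraicCycle.map τ.left Order.height Order.height (Motives.primeCycle ω) = Motives.primeCycle z →
      g.left.base η = z ∧ τ.left.base ω = z ∧ Function.Surjective (τ.left.residueFieldMap ω) := by
  classical
  intro n d X V W _ _ _ g τ _ _ η ω _ _ z k hk hg hτ
  have hτ' : AlgebraicCycle.map τ.left height height (Motives.primeCycle ω) =
      (1 : ℕ) • Motives.primeCycle z := by
    rw [one_nsmul]
    exact hτ
  have hgz := base_eq_of_map_primeCycle_eq_nsmul g hk.ne' hg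
  have hτz := base_eq_of_map_primeCycle_eq_nsmul τ one_ne_zero hτ'
  refine ⟨hgz, hτz, residueFieldMap_surjective_of_residueDegree_eq_one τ.left ω ?_⟩
  -- the push-forward coefficient of `τ` at `ω` is `1`
  have hh := height_eq_of_map_primeCycle_eq_nsmul τ one_ne_zero hτ'
  have h1 := congrArg (fun c : AlgebraicCycle X.left ℤ ↦ c z) hτ
  simp only [Motives.algebraicCycleMap_primeCycle_eq_nsmul, Function.locallyFinsuppWithin.coe_nsmul,
    Pi.smul_apply, hτz, Motives.primeCycle_apply_self, nsmul_eq_mul, mul_one] at h1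
  simp only [AlgebraicCycle.mapCoeff, hτz, if_pos hh.symm] at h1
  exact_mod_cast h1

/-- **Degree bookkeeping on a resolved square.** Let `X, V, W, T` be smooth projective over `ℂ`
(`dim V = dim W = d`, `dim T = d'`), `g : V ⟶ X`, `τ : W ⟶ X`, `p : T ⟶ V`, `q : T ⟶ W` with
`p ≫ g = q ≫ τ`, `p` birational, `g_*[V] = k • [closure {z}]` (`k ≥ 1`) and `τ_*[W] = [closure {z}]`.
Then `d' = d`, `q` sends the generic point `θ` of `T` to the generic point `ω` of `W`, and
`q_*[T] = k • [W]`: indeed `τ_* q_* [T] = (q ≫ τ)_* [T] = (p ≫ g)_* [T] = g_* p_* [T] = g_* [V] = k • [Z]`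
(functoriality of proper push-forward, `p_*[T] = [V]` as `κ(η_V) = κ(θ)`), so `q_*[T] ≠ 0` has the top
dimension `d` and its support `closure {q θ}` is `W`. Packaged in the shape of hypothesis `h5` of
`Fulton1998_degreeFormula_complexOrientation_of`. [cite: Fulton1998, §1.4] [cite: StacksProject, Tag 02R5] -/
theorem exists_resolution_of_degree_eq_of_comp_eq :
    ∀ ⦃n d d' e : ℕ⦄ ⦃X V W T : Motives.SchemeOver ℂ⦄ (hX : Motives.IsSmoothProjective n X)
      (hV : Motives.IsSmoothProjective d V) (hW : Motives.IsSmoothProjective d W) (hT : Motives.IsSmoothProjective d' T)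
      (_hde : d + e = n) (g : V ⟶ X) (τ : W ⟶ X) (p : T ⟶ V) (q : T ⟶ W) [QuasiCompact g.left] [QuasiCompact τ.left]
      ⦃η : V.left⦄ ⦃ω : W.left⦄, IsGenericPoint η Set.univ → IsGenericPoint ω Set.univ → ∀ ⦃z : X.left⦄ ⦃k : ℕ⦄, 0 < k →
      AlgebraicCycle.map g.left Order.height Order.height (Motives.primeCycle η) = k • Motives.primeCycle z →
      AlgebraicCycle.map τ.left Order.height Order.height (Motives.primeCycle ω) = Motives.primeCycle z →
      p ≫ g = q ≫ τ → Resolution.IsBirational p.left →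
      ∃ (T : Motives.SchemeOver ℂ) (_ : Motives.IsSmoothProjective d T) (p : T ⟶ V) (q : T ⟶ W)
        (_ : QuasiCompact q.left) (θ : T.left), IsGenericPoint θ Set.univ ∧ p ≫ g = q ≫ τ ∧
        Resolution.IsBirational p.left ∧
        AlgebraicCycle.map q.left Order.height Order.height (Motives.primeCycle θ) = k • Motives.primeCycle ω := by
  classical
  intro n d d' e X V W T hX hV hW hT _ g τ p q _ _ η ω hη hω z k hk hg hτ hsq hbir
  -- instances
  haveI : IsIntegral T.left := Motives.IsSmoothProjective.isIntegral_holds hT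
  haveI : IsIntegral V.left := Motives.IsSmoothProjective.isIntegral_holds hV
  haveI : IsIntegral W.left := Motives.IsSmoothProjective.isIntegral_holds hW
  haveI : IsProper T.hom := Motives.IsSmoothProjective.isProper_holds hT
  haveI : IsProper V.hom := Motives.IsSmoothProjective.isProper_holds hV
  haveI : IsProper W.hom := Motives.IsSmoothProjective.isProper_holds hW
  haveI : IsProper X.hom := Motives.IsSmoothProjective.isProper_holds hX
  have properOf : ∀ {A B : Motives.SchemeOver ℂ} (f : A ⟶ B) [IsProper A.hom] [IsProper B.hom],
      IsProper f.left := fun {A B} f _ _ ↦ by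
    haveI : IsProper (f.left ≫ B.hom) := by rw [Over.w f]; infer_instance
    exact IsProper.of_comp f.left B.hom
  haveI := properOf p
  haveI := properOf q
  haveI := properOf g
  haveI := properOf τ
  -- generic points
  have hηg : η = genericPoint V.left := hη.eq (genericPoint_spec V.left)
  have hωg : ω = genericPoint W.left := hω.eq (genericPoint_spec W.left)
  set θ : T.left := genericPoint T.left with hθdef
  have hθ : IsGenericPoint θ Set.univ := by simpa using genericPoint_spec T.left
  -- `p θ = η` and `p_*[T] = [V]`
  haveI : IsDominant p.left := hbir.isDominant
  have hpθ : p.left.base θ = η := by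
    rw [hηg]
    exact Literature.AlgebraicGeometry.Morphisms.base_genericPoint_eq p.left
      (IsDominant.denseRange (f := p.left))
  have hsurjp : Function.Surjective (p.left.residueFieldMap θ) :=
    residueFieldMap_genericPoint_surjective_of_isBirational hbir
  haveI : LocallyOfFiniteType V.hom := locallyOfFiniteType_of_isSmoothProjective hV
  haveI : LocallyOfFiniteType (p.left ≫ V.hom) := by
    rw [Over.w p]; exact locallyOfFiniteType_of_isSmoothProjective hT
  have hpT : AlgebraicCycle.map p.left height height (Motives.primeCycle θ) = Motives.primeCycle η := by
    rw [← hpθ]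
    exact Motives.algebraicCycleMap_primeCycle_of_residueFieldMap_surjective p.left V.hom θ hsurjp
  -- `τ_* q_* [T] = k • [Z]`
  have hsq' : q.left ≫ τ.left = p.left ≫ g.left := (congrArg CommaMorphism.left hsq).symm
  have hcomp : AlgebraicCycle.map τ.left height height
      (AlgebraicCycle.map q.left height height (Motives.primeCycle θ)) = k • Motives.primeCycle z := by
    rw [← Motives.algebraicCycleMap_comp q.left τ.left q.left.isClosedMap τ.left.isClosedMap,
      algebraicCycleMap_congr hsq' height height (Motives.primeCycle θ),
      Motives.algebraicCycleMap_comp p.left g.left p.left.isClosedMap g.left.isClosedMap, hpT, hg]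
  -- read off: `τ (q θ) = z`, coefficients multiply to `k`
  rw [Motives.algebraicCycleMap_primeCycle_eq_nsmul q.left θ, Motives.algebraicCycleMap_nsmul,
    Motives.algebraicCycleMap_primeCycle_eq_nsmul τ.left (q.left.base θ), smul_smul] at hcomp
  have hkne : k ≠ 0 := hk.ne'
  have hbase : τ.left.base (q.left.base θ) = z := by
    by_contra hne
    have h1 := congrArg (fun c : AlgebraicCycle X.left ℤ ↦ c z) hcomp
    simp only [Function.locallyFinsuppWithin.coe_nsmul, Pi.smul_apply, Motives.primeCycle_apply_self,
      Motives.primeCycle_apply_of_ne (Ne.symm hne), smul_zero, nsmul_eq_mul, mul_one] at h1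
    exact hkne (by exact_mod_cast h1.symm)
  have hprod : AlgebraicCycle.mapCoeff q.left height height θ *
      AlgebraicCycle.mapCoeff τ.left height height (q.left.base θ) = k := by
    have h1 := congrArg (fun c : AlgebraicCycle X.left ℤ ↦ c z) hcomp
    simp only [Function.locallyFinsuppWithin.coe_nsmul, Pi.smul_apply, hbase, Motives.primeCycle_apply_self,
      nsmul_eq_mul, mul_one] at h1
    exact_mod_cast h1
  have hcq : AlgebraicCycle.mapCoeff q.left height height θ ≠ 0 := fun h0 ↦ hkne (by
    rw [h0, zero_mul] at hprod; exact hprod.symm)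
  -- heights: `height θ = d'`, `height (q θ) = height θ`, `height ω = d`, `height z = height η = d`
  have hθd' : height θ = d' := height_eq_of_isGenericPoint hT hθ
  have hηd : height η = d := height_eq_of_isGenericPoint hV hη
  have hωd : height ω = d := height_eq_of_isGenericPoint hW hω
  have hqθ : height θ = height (q.left.base θ) := by
    by_contra hne
    exact hcq (by simp [AlgebraicCycle.mapCoeff, hne])
  have hcτ : AlgebraicCycle.mapCoeff τ.left height height (q.left.base θ) ≠ 0 := fun h0 ↦ hkne (by
    rw [h0, mul_zero] at hprod; exact hprod.symm)
  have hτq : height (q.left.base θ) = height z := by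
    by_contra hne
    apply hcτ
    simp only [AlgebraicCycle.mapCoeff, hbase]
    rw [if_neg hne]
  have hzη : height z = height η := height_eq_of_map_primeCycle_eq_nsmul g hkne hg
  -- so `d' = d` and `q θ = ω`
  have hdd : d' = d := by
    have h : ((d' : ℕ∞)) = d := by rw [← hθd', hqθ, hτq, hzη, hηd]
    exact_mod_cast h
  subst hdd
  have hqω : q.left.base θ = ω := by
    have h1 : height (q.left.base θ) = (d' : ℕ∞) := by rw [← hqθ, hθd']
    rw [hωg]
    exact Motives.eq_genericPoint_of_height_eq (height_genericPoint_of_isSmoothProjective hW) h1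
  -- the coefficient of `q` is `k`: `τ_*[ω] = [z]` has coefficient `1`
  have hτ1 : AlgebraicCycle.mapCoeff τ.left height height ω = 1 := by
    have hτz : τ.left.base ω = z := by rw [← hqω]; exact hbase
    have h1 := congrArg (fun c : AlgebraicCycle X.left ℤ ↦ c z) hτ
    simp only [Motives.algebraicCycleMap_primeCycle_eq_nsmul, Function.locallyFinsuppWithin.coe_nsmul,
      Pi.smul_apply, hτz, Motives.primeCycle_apply_self, nsmul_eq_mul, mul_one] at h1
    exact_mod_cast h1
  rw [hqω, hτ1, mul_one] at hprod
  refine ⟨T, hT, p, q, inferInstance, θ, hθ, hsq, hbir, ?_⟩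
  rw [Motives.algebraicCycleMap_primeCycle_eq_nsmul q.left θ, hqω, hprod]

end HodgeTheory

end Literature.AlgebraicGeometry.HodgeTheory

end
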